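import Literature.Computability.Complexity.HiraharaMachineEval
import HarnessLib

/-!
# The machine of Hirahara's reduction, V: the main output on lists agrees with the specification

Topic `Computability/Complexity`. For an instance `I₀` whose preprocessed `Pre.toPInst I₀` is `Big`
(`HiraharaAsymptotics.lean`; this holds in the main branch of `redOut`), the list-level output
`mainOutT I₀.toTuple r` of part IV is the specified output
`(Pre.toPInst I₀).output ((Pre.toPInst I₀).coinsOf r)` (`mainOutT_toTuple`): coins, design
positions, amplified functions, NW outputs, shares and the table value are identified one by one.

## References

* S. Hirahara, *NP-hardness of learning programs and partial MCSP*, ECCC TR22-119, proofs of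
  Lemma 8.1, Lemma 8.3 and Thm. 8.5 [Hirahara2022PartialMCSP].
-/

namespace Literature.Computability.Complexity

open Finset
open _root_.Computability
open Literature.Computability.MetaComplexity (MonotoneDNF CMMSAInstance lexWords boolFunEquivFin)
open CSPToCMMSAMachine (TO)

namespace HiraharaMachine

/-! ### Bits, parities, `𝔽₂` -/

/-- `parityFin` is the XOR-fold of the listed bits. [folklore] -/
private theorem parityFin_eq_parityT : ∀ (M : ℕ) (z : Fin M → Bool), parityFin M z = parityT (List.ofFn z)
  | 0, _ => rfl
  | M + 1, z => by
    rw [parityFin, List.ofFn_succ', List.concat_eq_append, parityFin_eq_parityT M]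
    unfold parityT
    rw [List.foldl_append, List.foldl_cons, List.foldl_nil]

/-- `(range M).map (g ∘ val)` is `ofFn g`. [folklore] -/
private theorem map_range_eq_ofFn {α : Type} {M : ℕ} (g : Fin M → α) (g' : ℕ → α) (h : ∀ i : Fin M, g i = g' i) :
    (List.range M).map g' = List.ofFn g := by
  rw [List.ofFn_eq_map]
  apply List.ext_getElem
  · simp
  · intro i h1 h2; simp [← h ⟨i, by simpa using h1⟩]

/-- A sum of `bz`s in `𝔽₂` is the `bz` of the parity. [folklore] -/
private theorem sum_bz_eq : ∀ (M : ℕ) (w : Fin M → Bool), (∑ c : Fin M, HiraharaRed.bz (w c)) = HiraharaRed.bz (parityT (List.ofFn w))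
  | 0, _ => by simp [parityT, HiraharaRed.bz]
  | M + 1, w => by
    rw [Fin.sum_univ_castSucc, sum_bz_eq M, List.ofFn_succ', List.concat_eq_append]
    unfold parityT
    rw [List.foldl_append, List.foldl_cons, List.foldl_nil]
    generalize (List.foldl xor false (List.ofFn fun i : Fin M => w i.castSucc)) = a
    cases a <;> cases w (Fin.last M) <;> decide

/-- `bz a * [tb] = bz (tb && a)`. [folklore] -/
private theorem bz_mul_indicator (a tb : Bool) : HiraharaRed.bz a * (if tb then 1 else 0 : ZMod 2) = HiraharaRed.bz (tb && a) := by
  cases a <;> cases tb <;> decide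

/-- `bz a + bz c = bz (a ⊕ c)`. [folklore] -/
private theorem bz_add (a c : Bool) : HiraharaRed.bz a + HiraharaRed.bz c = HiraharaRed.bz (xor a c) := by
  cases a <;> cases c <;> decide

/-- The value of a listed bit vector is its `boolFunEquivFin` index. [folklore] -/
private theorem valT_ofFn : ∀ {N : ℕ} (v : Fin N → Bool), valT (List.ofFn v) = (boolFunEquivFin N v).val
  | 0, v => by simp [valT, MetaComplexity.boolFunEquivFin]
  | N + 1, v => by
    rw [List.ofFn_succ, valT, valT_ofFn]
    change Nat.bit (v 0) ((finFunctionFinEquiv fun i : Fin N => finTwoEquiv.symm (v i.succ)) : ℕ) =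
      ((finFunctionFinEquiv fun i : Fin (N + 1) => finTwoEquiv.symm (v i)) : ℕ)
    rw [finFunctionFinEquiv_apply, finFunctionFinEquiv_apply, Fin.sum_univ_succ, Nat.bit_val]
    simp only [Fin.val_zero, pow_zero, mul_one, Fin.val_succ, pow_succ]
    rw [Finset.mul_sum, add_comm]
    congr 1
    · cases v 0 <;> simp [finTwoEquiv]
    · exact Finset.sum_congr rfl fun i _ => by ring

/-- `valT v < 2^{|v|}`. [folklore] -/
private theorem valT_lt : ∀ v : List Bool, valT v < 2 ^ v.length
  | [] => by simp [valT]
  | b :: v => by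
    rw [valT, List.length_cons, Nat.bit_val, pow_succ]
    have := valT_lt v
    cases b <;> simp <;> omega

/-- The binary digits of `valT v` are `v`. [folklore] -/
private theorem testBit_valT : ∀ (v : List Bool) (p : ℕ), (valT v).testBit p = v.getD p false
  | [], p => by simp [valT]
  | b :: v, 0 => by rw [valT, Nat.testBit_bit_zero]; rfl
  | b :: v, p + 1 => by rw [valT, Nat.testBit_bit_succ, testBit_valT v p]; rfl

/-- **Every bit list of length `L` is listed by `allBitsT u L`** once `2^L ≤ u`. [folklore] -/
theorem mem_allBitsT {u L : ℕ} (hu : 2 ^ L ≤ u) {v : List Bool} (hv : v.length = L) : v ∈ allBitsT u L := by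
  unfold allBitsT
  rw [min_eq_left hu]
  refine List.mem_map.2 ⟨valT v, List.mem_range.2 (hv ▸ valT_lt v), ?_⟩
  apply List.ext_getElem
  · simp [hv]
  · intro p h1 h2
    simp only [List.getElem_map, List.getElem_range, testBit_valT]
    rw [List.getD_eq_getElem _ _ h2]

/-- The listed bit lists have length `L`. [folklore] -/
theorem length_of_mem_allBitsT {u L : ℕ} {v : List Bool} (hv : v ∈ allBitsT u L) : v.length = L := by
  unfold allBitsT at hv
  obtain ⟨i, -, rfl⟩ := List.mem_map.1 hv
  simp

/-- The bits of `(boolFunEquivFin L).symm i` are the binary digits of `i`. [folklore] -/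
private theorem boolFunEquivFin_symm_testBit {L : ℕ} (i : Fin (2 ^ L)) (p : Fin L) : (boolFunEquivFin L).symm i p = i.val.testBit p := by
  have hx : ((finFunctionFinEquiv.symm i) p : ℕ) = i / 2 ^ (p : ℕ) % 2 := finFunctionFinEquiv_symm_apply_val i p
  simp only [MetaComplexity.boolFunEquivFin, Equiv.arrowCongr, finTwoEquiv, Nat.testBit_eq_decide_div_mod_eq,
    Equiv.symm_trans_apply, Equiv.coe_fn_symm_mk, Equiv.refl_symm, Equiv.coe_refl, Function.comp_apply, id,
    Equiv.symm_symm, Equiv.coe_fn_mk]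
  rw [Bool.eq_iff_iff, beq_iff_eq, decide_eq_true_iff, Fin.ext_iff, hx]; rfl

section Agree

variable (I₀ : CMMSAInstance) (hwf : I₀.weight.length = I₀.numVars) (r : List Bool)

local notation "I" => HiraharaRed.Pre.toPInst I₀
local notation "t" => CMMSAInstance.toTuple I₀

/-! ### Coins -/

include hwf in
/-- **The coin lookup agrees with `coinsOf`.** [folklore] -/
theorem coinT_toTuple (k : Fin I₀.numVars) (v : Fin ((I).N k) → Bool) :
    coinT t r k (List.ofFn v) = (I).coinsOf r k v := by
  unfold coinT HiraharaRed.PInst.coinsOf HiraharaRed.PInst.pos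
  rw [show min k.val (nT t) = k.val from min_eq_left (by rw [nT_toTuple I₀ hwf]; exact k.isLt.le),
    offT_toTuple I₀ hwf k, valT_ofFn]

/-! ### The budget dominates the enumerations -/

include hwf in
/-- **`2^X ≤ budget` for `X ≤ 4^{143} Λ`.** [folklore] -/
theorem two_pow_le_budgetT {X : ℕ} (hX : X ≤ 4 ^ 143 * (I).logLam) : 2 ^ X ≤ budgetT t := by
  unfold budgetT
  rw [sizeOfT_toTuple I₀ hwf]
  obtain ⟨C, hC⟩ : ∃ C : ℕ, 4 ^ 143 = C := ⟨_, rfl⟩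
  rw [hC] at hX ⊢
  set s := HiraharaRed.Pre.sizeOf I₀
  have hΛ : (I).logLam = 4 * (Nat.log 2 s + 1) + 4096 := rfl
  -- `2^{log s + 1} ≤ 2 s + 2`
  have h2 : 2 ^ (Nat.log 2 s + 1) ≤ 2 * s + 2 := by
    rcases Nat.eq_zero_or_pos s with h0 | hpos
    · rw [h0]; simp
    · rw [pow_succ]; have := Nat.pow_log_le_self 2 hpos.ne'; omega
  have hexp : C * (I).logLam = (Nat.log 2 s + 1) * (4 * C) + 4096 * C := by rw [hΛ]; ring
  calc 2 ^ X ≤ 2 ^ (C * (I).logLam) := Nat.pow_le_pow_right (by norm_num) hX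
    _ = (2 ^ (Nat.log 2 s + 1)) ^ (4 * C) * 2 ^ (4096 * C) := by rw [hexp, pow_add, pow_mul]
    _ ≤ (2 * s + 2) ^ (4 * C) * 2 ^ (4096 * C) := Nat.mul_le_mul_right _ (Nat.pow_le_pow_left h2 _)

/-- `4^{143} = 64 · 4^{140}`. [folklore] -/
private theorem four_pow_143 : (4 : ℕ) ^ 143 = 64 * 4 ^ 140 := by
  rw [show (143 : ℕ) = 3 + 140 from rfl, pow_add]; norm_num

include hwf in
/-- The amplification design candidates fit the budget: `16^{N_k} ≤ budget`. [folklore] -/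
theorem sixteen_pow_N_le_budgetT (hB : (I).Big) (k : Fin I₀.numVars) : 16 ^ (I).N k ≤ budgetT t := by
  rw [show (16 : ℕ) = 2 ^ 4 by norm_num, ← pow_mul]
  refine two_pow_le_budgetT I₀ hwf ?_
  have h1 := hB.N_le k
  have hΛ := hB.Λ_ge
  have hD : 1 ≤ 4 ^ 140 := Nat.one_le_pow _ _ (by norm_num)
  rw [four_pow_143]
  calc 4 * (I).N k ≤ 16 * (I).logLam := by omega
    _ ≤ 64 * 4 ^ 140 * (I).logLam := Nat.mul_le_mul_right _ (by omega)

include hwf in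
/-- The amplification design words are the greedy words. [folklore] -/
theorem AWT_eq (hB : (I).Big) (k : Fin I₀.numVars) : AWT t k = lexWordsT ((I).N k) 16 ((I).N k / 2) := by
  unfold AWT
  rw [NT_toTuple I₀ hwf k]
  exact lexWordsCapT_eq (sixteen_pow_N_le_budgetT I₀ hwf hB k)

include hwf in
/-- The NW design words are the greedy words. [folklore] -/
theorem EWT_eq (hB : (I).Big) : EWT t = lexWordsT (I).ℓ (4 ^ 140) ((I).ℓ / 140) := by
  unfold EWT
  rw [ℓT_toTuple I₀ hwf]
  refine lexWordsCapT_eq ?_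
  rw [show (4 : ℕ) ^ 140 = 2 ^ 280 by rw [show (4 : ℕ) = 2 ^ 2 by norm_num, ← pow_mul], ← pow_mul]
  refine two_pow_le_budgetT I₀ hwf ?_
  have h1 := hB.ℓ_le
  have hD : 1 ≤ 4 ^ 140 := Nat.one_le_pow _ _ (by norm_num)
  rw [four_pow_143]
  calc 280 * (I).ℓ ≤ 10640 * (I).logLam := by omega
    _ ≤ 64 * 4 ^ 140 * (I).logLam := Nat.mul_le_mul_right _ (by omega)

include hwf in
/-- The table indices fit the budget. [folklore] -/
theorem two_pow_Lx_le_budgetT (hB : (I).Big) : 2 ^ LxT t ≤ budgetT t := by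
  refine two_pow_le_budgetT I₀ hwf ?_
  rw [LxT_toTuple I₀ hwf]
  unfold HiraharaRed.Lx HiraharaRed.PInst.dNW
  have h1 : (I).Lj ≤ (I).logLam / 4 + 1 := by
    unfold HiraharaRed.PInst.Lj
    have := Nat.log_mono_right (b := 2) hB.ν_le
    rw [Nat.log_pow (by norm_num)] at this
    omega
  have h2 := hB.ℓ_le
  have h3 := hB.Δsq_le
  have hΛ := hB.Λ_ge
  obtain ⟨D, hD⟩ : ∃ D : ℕ, 4 ^ 140 = D := ⟨_, rfl⟩
  have hD1 : 1 ≤ D := hD ▸ Nat.one_le_pow _ _ (by norm_num)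
  rw [four_pow_143, hD]
  have hℓD : (I).ℓ * D ≤ 38 * (I).logLam * D := Nat.mul_le_mul_right _ h2
  calc (I).Lj + ((I).ℓ * D + (I).Δ * (I).Δ) ≤ (I).logLam + 38 * (I).logLam * D := by omega
    _ ≤ 64 * D * (I).logLam := by nlinarith

include hwf in
/-- The sharing coins fit the budget. [folklore] -/
theorem two_pow_nCoins_le_budgetT (hB : (I).Big) (j : Fin (I).ν) :
    2 ^ (((I).φ j).length * ((I).φ j).numLiterals) ≤ budgetT t := by
  have h := hB.card_Rand_le j
  rw [Fintype.card_fun, Fintype.card_bool, Fintype.card_prod, Fintype.card_fin, Fintype.card_fin] at h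
  refine h.trans (two_pow_le_budgetT I₀ hwf ?_)
  calc (I).logLam = 1 * (I).logLam := (one_mul _).symm
    _ ≤ 4 ^ 143 * (I).logLam := Nat.mul_le_mul_right _ (Nat.one_le_pow _ _ (by norm_num))

/-! ### Design positions -/

include hwf in
/-- **The amplification design positions** (under `Big`). [folklore] -/
theorem eAposT_toTuple (hB : (I).Big) (k : Fin I₀.numVars) (q : Fin (I).kA) (rr : Fin ((I).N k)) :
    eAposT t k q rr = ((I).A.eA k q rr).val := by
  change _ = ((I).eA k q rr).val
  rw [hB.eA_eq k]
  unfold eAposT MetaComplexity.NWLexLinear.linDesign MetaComplexity.lexDesign MetaComplexity.lexDesignWords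
  rw [AWT_eq I₀ hwf hB k]
  have hq : q.val < (lexWords ((I).N k) (4 ^ 2) ((I).N k / 2)).length :=
    lt_of_lt_of_le q.isLt (MetaComplexity.NWLexLinear.le_length_lexWords_pow4 le_rfl (by have := (I).logLam_lt_N k; omega)
      (hB.kA_lt_two_pow.le.trans (Nat.pow_le_pow_right (by norm_num) ((I).logLam_lt_N k).le)))
  rw [show (16 : ℕ) = 4 ^ 2 by norm_num, getD_getD_lexWordsT hq rr]
  simp only [Function.Embedding.trans_apply, Equiv.toEmbedding_apply, MetaComplexity.graphBlock_apply,
    finProdFinEquiv_apply_val, List.get_eq_getElem, Fin.val_castLE]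

include hwf in
/-- **The Nisan–Wigderson design positions** (under `Big`). [folklore] -/
theorem EposT_toTuple (hB : (I).Big) (k : Fin I₀.numVars) (tt : Fin (I).Δ) (x : Fin (I).ℓ) :
    EposT t k tt x = ((I).E (k, tt) x).val := by
  rw [hB.E_eq]
  unfold EposT MetaComplexity.NWLexLinear.linDesign MetaComplexity.lexDesign MetaComplexity.lexDesignWords
  rw [EWT_eq I₀ hwf hB, ΔT_toTuple I₀ hwf]
  have hi : tt.val + (I).Δ * k.val < (lexWords (I).ℓ (4 ^ 140) ((I).ℓ / 140)).length := by
    have h := lt_of_lt_of_le (finProdFinEquiv (k, tt)).isLt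
      (MetaComplexity.NWLexLinear.le_length_lexWords_pow4 (r := 140) (by norm_num) hB.one_le_ℓ hB.nΔ_le_two_pow_ℓ)
    rwa [finProdFinEquiv_apply_val] at h
  rw [getD_getD_lexWordsT hi x]
  simp only [finProdFinEquiv_apply_val, List.get_eq_getElem, Fin.val_castLE]
  rfl

/-! ### The amplified functions -/

/-- The wires of the layout: first field. [folklore] -/
theorem lay_inl_val (k : Fin I₀.numVars) (i : Fin ((I).A.dA k)) : ((I).L.lay k (Sum.inl i)).val = i.val := by
  simp only [HiraharaRed.PInst.L, HiraharaRed.mkLayout, HiraharaRed.blockLay, finCongr_apply, Fin.val_cast,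
    Fin.val_castAdd]

/-- The wires of the layout: Hankel `t` field. [folklore] -/
theorem lay_inr_inl_val (k : Fin I₀.numVars) (c : Fin ((I).A.N k + (I).A.mI k)) :
    ((I).L.lay k (Sum.inr (Sum.inl c))).val = (I).N k * 4 ^ 2 + c.val := by
  simp only [HiraharaRed.PInst.L, HiraharaRed.mkLayout, HiraharaRed.blockLay, finCongr_apply, Fin.val_cast,
    Fin.val_castAdd, Fin.val_natAdd]
  rfl

/-- The wires of the layout: Hankel `b` field. [folklore] -/
theorem lay_inr_inr_val (k : Fin I₀.numVars) (i : Fin ((I).A.N k)) :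
    ((I).L.lay k (Sum.inr (Sum.inr i))).val = (I).N k * 4 ^ 2 + (((I).N k + (I).mI) + i.val) := by
  simp only [HiraharaRed.PInst.L, HiraharaRed.mkLayout, HiraharaRed.blockLay, finCongr_apply, Fin.val_cast,
    Fin.val_castAdd, Fin.val_natAdd]
  rfl

/-- Reading a listed block at a wire. [folklore] -/
private theorem getD_ofFn_fin {ℓ : ℕ} (y : Fin ℓ → Bool) (p : Fin ℓ) : (List.ofFn y).getD p.val false = y p := by
  rw [List.getD_eq_getElem _ _ (by simp), List.getElem_ofFn]

include hwf in
/-- **The query inputs agree**: `inpT` lists `inp` on the seed read off the block. [cite: Hirahara2022PartialMCSP, proof of Lemma 8.1] -/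
theorem inpT_toTuple (hB : (I).Big) (k : Fin I₀.numVars) (y : Fin (I).ℓ → Bool) (q : Fin (I).kA) :
    inpT t k (List.ofFn y) q = List.ofFn (IWAmp.inp ((I).A.eA k) ((I).A.idxA k) q
      (HiraharaRed.seedOf fun sb => y ((I).L.lay k sb))) := by
  unfold inpT
  rw [NT_toTuple I₀ hwf, mIT_toTuple I₀ hwf]
  refine map_range_eq_ofFn _ _ fun rr => ?_
  -- bit `rr`
  unfold IWAmp.inp IWAmp.hitB Hankel.gen Hankel.mulVec HiraharaRed.seedOf
  simp only
  congr 1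
  · -- the `x`-field bit at the design position
    rw [eAposT_toTuple I₀ hwf hB k q rr, ← lay_inl_val I₀ k, getD_ofFn_fin]
  · -- the Hankel hit bit
    have hidx : ∀ c : Fin (I).mI, (I).A.idxA k q c = if q.val.testBit c then 1 else 0 := fun c => rfl
    simp only [Pi.add_apply, hidx, bz_mul_indicator]
    rw [sum_bz_eq, bz_add, HiraharaRed.decide_bz_ne_zero]
    congr 2
    · symm
      refine map_range_eq_ofFn _ _ fun c => ?_
      congr 1
      have e1 : (I).A.N k = (I).N k := rfl
      have e2 : (I).A.mI k = (I).mI := rfl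
      have hlt : rr.val + c.val < (I).A.N k + (I).A.mI k := by rw [e1, e2]; omega
      rw [show (I).N k * 4 ^ 2 + (rr.val + c.val) = ((I).L.lay k (Sum.inr (Sum.inl ⟨rr + c, hlt⟩))).val from
        (lay_inr_inl_val I₀ k ⟨rr + c, hlt⟩).symm, getD_ofFn_fin]
    · rw [← lay_inr_inr_val I₀ k rr, getD_ofFn_fin]

include hwf in
/-- **The amplified functions agree**: `fhatT` lists `Fhat`. [cite: Hirahara2022PartialMCSP, proof of Lemma 8.1 (Amp^f)] -/
theorem fhatT_toTuple (hB : (I).Big) (k : Fin I₀.numVars) (y : Fin (I).ℓ → Bool) :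
    fhatT t r k (List.ofFn y) = HiraharaRed.Fhat (I).A ((I).coinsOf r) k y := by
  rw [HiraharaRed.Fhat_apply]
  unfold HiraharaRed.fhat IWAmp.amp fhatT
  rw [(I).L.spec k y, parityFin_eq_parityT, kAT_toTuple I₀ hwf]
  congr 1
  refine map_range_eq_ofFn _ _ fun q => ?_
  rw [← coinT_toTuple I₀ hwf r k, inpT_toTuple I₀ hwf hB k y q]
  rfl

/-! ### Blocks, slots and the mask -/

include hwf in
/-- The NW block of `(k, tt)` read off a listed seed. [folklore] -/
theorem blockT_toTuple (hB : (I).Big) (z : Fin (I).dNW → Bool) (k : Fin I₀.numVars) (tt : Fin (I).Δ) :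
    blockT t (List.ofFn z) k tt = List.ofFn fun x : Fin (I).ℓ => z ((I).E (k, tt) x) := by
  unfold blockT
  rw [ℓT_toTuple I₀ hwf]
  refine map_range_eq_ofFn _ _ fun x => ?_
  rw [EposT_toTuple I₀ hwf hB k tt x, getD_ofFn_fin]

omit hwf in
/-- The kept formula `j`. [folklore] -/
theorem φT_toTuple (j : Fin (I).ν) : φT t j = (I).φ j := by
  unfold φT
  rw [keptT_toTuple, List.getD_eq_getElem _ _ j.isLt]; rfl

omit hwf in
/-- The distinct variables of formula `j`. [folklore] -/
theorem varsT_toTuple (j : Fin (I).ν) : varsT t j = (I).vars j := by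
  unfold varsT HiraharaRed.PInst.vars; rw [φT_toTuple I₀ j]

include hwf in
/-- **The slots agree.** [folklore] -/
theorem slotT_toTuple (j : Fin (I).ν) (s : Fin (I).Δ) : slotT t j s = ((I).slot j s).map Fin.val := by
  unfold slotT HiraharaRed.PInst.slot
  rw [varsT_toTuple I₀ j, show nT t = (I).n from nT_toTuple I₀ hwf]
  by_cases h : s.val < ((I).vars j).length
  · rw [if_pos h, dif_pos h, List.getD_eq_getElem _ _ h]
    by_cases hv : ((I).vars j)[s.val] < (I).n
    · rw [if_pos hv, dif_pos hv]; rfl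
    · rw [if_neg hv, dif_neg hv]; rfl
  · rw [if_neg h, dif_neg h]; rfl

include hwf in
/-- **The mask rows agree**: the NW outputs of the slot variables. [cite: Hirahara2022PartialMCSP, proof of Lemma 8.3] -/
theorem maskRowT_toTuple (hB : (I).Big) (j : Fin (I).ν) (z : Fin (I).dNW → Bool) (s : Fin (I).Δ) :
    maskRowT t r j (List.ofFn z) s = List.ofFn fun tt : Fin (I).Δ =>
      HiraharaRed.readY (I).slot j (HiraharaRed.realY (I).E (HiraharaRed.Fhat (I).A ((I).coinsOf r)) z) s tt := by
  unfold maskRowT HiraharaRed.readY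
  rw [slotT_toTuple I₀ hwf j s]
  cases hs : (I).slot j s with
  | none =>
    simp only [Option.map_none]
    rw [ΔT_toTuple I₀ hwf]
    exact (List.ofFn_const _ _).symm
  | some k =>
    simp only [Option.map_some]
    rw [ΔT_toTuple I₀ hwf]
    refine map_range_eq_ofFn _ _ fun tt => ?_
    unfold HiraharaRed.realY NWExtract.real
    beta_reduce
    rw [← fhatT_toTuple I₀ hwf r hB k, blockT_toTuple I₀ hwf hB z k tt]

/-- The matrix of a slot-indexed bit family. [folklore] -/
def matT {mm Δ : ℕ} (M : Fin mm → Fin Δ → Bool) : List (List Bool) := List.ofFn fun s => List.ofFn fun tt => M s tt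

/-- `matT` is injective. [folklore] -/
theorem matT_injective {mm Δ : ℕ} : Function.Injective (matT (mm := mm) (Δ := Δ)) := by
  intro M M' h
  funext s tt
  have h1 := List.ofFn_injective h
  have h2 := List.ofFn_injective (congrFun h1 s)
  exact congrFun h2 tt

/-- Row-wise XOR of matrices. [folklore] -/
theorem xorRowsT_matT {mm Δ : ℕ} (A B : Fin mm → Fin Δ → Bool) :
    xorRowsT (matT A) (matT B) = matT (HiraharaRed.xorV A B) := by
  unfold xorRowsT matT HiraharaRed.xorV
  apply List.ext_getElem
  · simp
  · intro s h1 h2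
    simp only [List.getElem_zipWith, List.getElem_ofFn]
    apply List.ext_getElem
    · simp
    · intro tt h3 h4
      simp [List.getElem_zipWith, List.getElem_ofFn]

include hwf in
/-- **The mask agrees.** [cite: Hirahara2022PartialMCSP, proof of Lemma 8.3] -/
theorem maskT_toTuple (hB : (I).Big) (j : Fin (I).ν) (z : Fin (I).dNW → Bool) :
    maskT t r j (List.ofFn z) =
      matT (HiraharaRed.readY (I).slot j (HiraharaRed.realY (I).E (HiraharaRed.Fhat (I).A ((I).coinsOf r)) z)) := by
  unfold maskT matT
  rw [ΔT_toTuple I₀ hwf]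
  exact map_range_eq_ofFn _ _ fun s => (maskRowT_toTuple I₀ hwf r hB j z s).symm

/-! ### Shares -/

/-- The sharing coins read off a coin list. [folklore] -/
def rOf (φ : MonotoneDNF) (rbits : List Bool) : MonotoneDNF.BenalohLeichter.Rand φ :=
  fun kp => rbits.getD (kp.2.val + φ.numLiterals * kp.1.val) false

/-- `rbitT` reads `rbit` of `rOf`. [folklore] -/
theorem rbitT_eq (φ : MonotoneDNF) (rbits : List Bool) (k' p : ℕ) :
    rbitT φ rbits k' p = MonotoneDNF.BenalohLeichter.rbit φ (rOf φ rbits) k' p := by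
  unfold rbitT MonotoneDNF.BenalohLeichter.rbit rOf
  by_cases h : k' < φ.length ∧ p < φ.numLiterals
  · rw [if_pos h, dif_pos h]
  · rw [if_neg h, dif_neg h]

/-- The coin list of sharing coins. [folklore] -/
def bitsOf (φ : MonotoneDNF) (rr : MonotoneDNF.BenalohLeichter.Rand φ) : List Bool :=
  (List.range (φ.length * φ.numLiterals)).map fun idx =>
    MonotoneDNF.BenalohLeichter.rbit φ rr (idx / φ.numLiterals) (idx % φ.numLiterals)

/-- Length of the coin list. [folklore] -/
@[simp] theorem length_bitsOf (φ : MonotoneDNF) (rr : MonotoneDNF.BenalohLeichter.Rand φ) :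
    (bitsOf φ rr).length = φ.length * φ.numLiterals := by simp [bitsOf]

/-- Reading back the coins. [folklore] -/
theorem rOf_bitsOf (φ : MonotoneDNF) (rr : MonotoneDNF.BenalohLeichter.Rand φ) : rOf φ (bitsOf φ rr) = rr := by
  funext ⟨k', p⟩
  unfold rOf bitsOf
  have hL : 0 < φ.numLiterals := lt_of_le_of_lt (Nat.zero_le _) p.isLt
  have hidx : p.val + φ.numLiterals * k'.val < φ.length * φ.numLiterals := by
    have := k'.isLt; have := p.isLt; nlinarith
  rw [List.getD_eq_getElem _ _ (by simpa using hidx), List.getElem_map, List.getElem_range]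
  have h1 : (p.val + φ.numLiterals * k'.val) / φ.numLiterals = k'.val := by
    rw [Nat.add_mul_div_left _ _ hL, Nat.div_eq_of_lt p.isLt, zero_add]
  have h2 : (p.val + φ.numLiterals * k'.val) % φ.numLiterals = p.val := by
    rw [Nat.add_mul_mod_self_left, Nat.mod_eq_of_lt p.isLt]
  rw [h1, h2]
  unfold MonotoneDNF.BenalohLeichter.rbit
  rw [dif_pos ⟨k'.isLt, p.isLt⟩]

/-- XOR-folds from an arbitrary start. [folklore] -/
private theorem foldl_xor_eq (a : Bool) (l : List Bool) : l.foldl xor a = xor a (l.foldl xor false) := by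
  induction l generalizing a with
  | nil => simp
  | cons b l ih => rw [List.foldl_cons, List.foldl_cons, ih, ih (xor false b)]; cases a <;> cases b <;> simp

/-- A sum of `bitZ`s over a list is the `bitZ` of the parity. [folklore] -/
private theorem sum_map_bitZ (l : List ℕ) (f : ℕ → Bool) :
    (l.map fun p => MonotoneDNF.bitZ (f p)).sum = MonotoneDNF.bitZ (parityT (l.map f)) := by
  induction l with
  | nil => simp [parityT, MonotoneDNF.bitZ]
  | cons a l ih =>
    rw [List.map_cons, List.sum_cons, ih, List.map_cons]
    unfold parityT
    rw [List.foldl_cons, foldl_xor_eq (xor false (f a))]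
    generalize List.foldl xor false (List.map f l) = c
    cases f a <;> cases c <;> decide

/-- Filtered sums as sums with indicators. [folklore] -/
private theorem sum_map_filter_eq {M : Type} [AddCommMonoid M] (l : List ℕ) (P : ℕ → Bool) (h : ℕ → M) :
    ((l.filter P).map h).sum = (l.map fun p => if P p then h p else 0).sum := by
  induction l with
  | nil => simp
  | cons a l ih => rw [List.filter_cons, List.map_cons, List.sum_cons]; cases P a <;> simp [ih]

/-- The mask of a term as a parity over the listed positions `1 ≤ p < |term|`. [cite: Hirahara2022PartialMCSP, Lemma 4.5] -/
theorem mask_eq (φ : MonotoneDNF) (rbits : List Bool) (k' : ℕ) :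
    MonotoneDNF.BenalohLeichter.mask φ (rOf φ rbits) k' =
      MonotoneDNF.bitZ (parityT (((List.range (φ.termLen k')).filter fun p => decide (1 ≤ p)).map (rbitT φ rbits k'))) := by
  unfold MonotoneDNF.BenalohLeichter.mask
  rw [← sum_map_bitZ, sum_map_filter_eq]
  have hIco : Finset.Ico 1 (φ.termLen k') = (Finset.range (φ.termLen k')).filter fun p => 1 ≤ p := by
    ext p; simp [Finset.mem_Ico, and_comm]
  rw [hIco, Finset.sum_filter, ← MonotoneDNF.sum_map_range_eq_finset_sum]
  congr 1
  refine List.map_congr_left fun p _ => ?_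
  rw [rbitT_eq]
  by_cases hp : 1 ≤ p <;> simp [hp]

/-- **The share symbols agree.** [cite: Hirahara2022PartialMCSP, Lemma 4.5] -/
theorem symbolT_eq (φ : MonotoneDNF) (b : Bool) (rbits : List Bool) (kp : ℕ × ℕ) :
    symbolT φ b rbits kp = MonotoneDNF.zBit (MonotoneDNF.BenalohLeichter.symbol φ b (rOf φ rbits) kp) := by
  unfold symbolT MonotoneDNF.BenalohLeichter.symbol
  by_cases h0 : kp.2 = 0
  · rw [if_pos h0, if_pos h0, mask_eq]
    cases b <;> cases parityT _ <;> decide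
  · rw [if_neg h0, if_neg h0, MonotoneDNF.zBit_bitZ, rbitT_eq]

/-- **The shares agree.** [cite: Hirahara2022PartialMCSP, Lemma 4.5] -/
theorem shareT_eq (φ : MonotoneDNF) (b : Bool) (rbits : List Bool) (i : ℕ) :
    shareT φ b rbits i = MonotoneDNF.BenalohLeichter.share φ b (rOf φ rbits) i := by
  unfold shareT MonotoneDNF.BenalohLeichter.share
  exact List.map_congr_left fun kp _ => symbolT_eq φ b rbits kp

include hwf in
/-- **The share vectors agree.** [cite: Hirahara2022PartialMCSP, proof of Lemma 8.3 (sᵢ ∈ {0,1}^Δ)] -/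
theorem shareVecT_toTuple (j : Fin (I).ν) (b : Bool) (rbits : List Bool) :
    shareVecT t j b rbits = matT (HiraharaRed.shareVec (Δ := (I).Δ) (I).φ (I).slot j b (rOf ((I).φ j) rbits)) := by
  unfold shareVecT matT HiraharaRed.shareVec
  rw [ΔT_toTuple I₀ hwf, φT_toTuple I₀ j]
  refine map_range_eq_ofFn _ _ fun s => ?_
  rw [slotT_toTuple I₀ hwf j s]
  cases hs : (I).slot j s with
  | none => simp only [Option.map_none]; exact List.ofFn_const _ _
  | some k =>
    simp only [Option.map_some]
    refine (map_range_eq_ofFn _ _ fun tt => ?_).symm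
    rw [shareT_eq]

omit hwf in
/-- The number of sharing coins. [folklore] -/
theorem nCoinsT_toTuple (j : Fin (I).ν) : nCoinsT t j = ((I).φ j).length * ((I).φ j).numLiterals := by
  unfold nCoinsT; rw [φT_toTuple I₀ j]

include hwf in
/-- **The share search decides the existence of sharing coins.** [cite: Hirahara2022PartialMCSP, proof of Thm. 8.5 ((x, b) ∈ supp E_k)] -/
theorem hasShareT_iff (hB : (I).Big) (j : Fin (I).ν) (b : Bool) (M : Fin (I).Δ → Fin (I).Δ → Bool) :
    hasShareT t j b (matT M) = true ↔
      ∃ rr : MonotoneDNF.BenalohLeichter.Rand ((I).φ j), HiraharaRed.shareVec (Δ := (I).Δ) (I).φ (I).slot j b rr = M := by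
  unfold hasShareT
  rw [List.any_eq_true]
  constructor
  · rintro ⟨rbits, -, h⟩
    rw [decide_eq_true_iff, shareVecT_toTuple I₀ hwf] at h
    exact ⟨_, matT_injective h⟩
  · rintro ⟨rr, hrr⟩
    refine ⟨bitsOf ((I).φ j) rr, mem_allBitsT (by rw [nCoinsT_toTuple]; exact two_pow_nCoins_le_budgetT I₀ hwf hB j)
      (by rw [length_bitsOf, nCoinsT_toTuple]), ?_⟩
    rw [decide_eq_true_iff, shareVecT_toTuple I₀ hwf, rOf_bitsOf, hrr]

/-! ### The table value -/

/-- The number of index bits of the preprocessed instance. [folklore] -/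
noncomputable abbrev LxOf (I₀ : CMMSAInstance) : ℕ :=
  HiraharaRed.Lx (HiraharaRed.Pre.toPInst I₀).Lj (HiraharaRed.Pre.toPInst I₀).dNW (HiraharaRed.Pre.toPInst I₀).Δ
    (HiraharaRed.Pre.toPInst I₀).Δ

/-- Position of a `j`-bit. [folklore] -/
private theorem eX_inl_val {Lj dNW mm Δ : ℕ} (p : Fin Lj) : (HiraharaRed.eX Lj dNW mm Δ (Sum.inl p)).val = p.val := rfl

/-- Position of a seed bit. [folklore] -/
private theorem eX_inr_inl_val {Lj dNW mm Δ : ℕ} (q : Fin dNW) :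
    (HiraharaRed.eX Lj dNW mm Δ (Sum.inr (Sum.inl q))).val = Lj + q.val := rfl

/-- Position of a slot bit. [folklore] -/
private theorem eX_inr_inr_val {Lj dNW mm Δ : ℕ} (s : Fin mm) (tt : Fin Δ) :
    (HiraharaRed.eX Lj dNW mm Δ (Sum.inr (Sum.inr (s, tt)))).val = Lj + (dNW + (tt.val + Δ * s.val)) := rfl

/-- Low bits determine the residue. [folklore] -/
private theorem testBit_low_iff {L i j : ℕ} (hj : j < 2 ^ L) : (∀ p < L, i.testBit p = j.testBit p) ↔ i % 2 ^ L = j := by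
  constructor
  · intro h
    apply Nat.eq_of_testBit_eq
    intro p
    rw [Nat.testBit_mod_two_pow]
    by_cases hp : p < L
    · rw [decide_eq_true hp, Bool.true_and, h p hp]
    · rw [decide_eq_false hp, Bool.false_and]
      symm
      exact Nat.testBit_lt_two_pow (lt_of_lt_of_le hj (Nat.pow_le_pow_right (by norm_num) (not_lt.1 hp)))
  · intro h p hp
    rw [← h, Nat.testBit_mod_two_pow, decide_eq_true hp, Bool.true_and]

include hwf in
/-- The seed field as a listed vector. [folklore] -/
theorem zOfT_eq (i : ℕ) : zOfT t i = List.ofFn fun q : Fin (I).dNW => i.testBit ((I).Lj + q.val) := by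
  unfold zOfT; rw [dNWT_toTuple I₀ hwf, LjT_toTuple]
  exact map_range_eq_ofFn _ _ fun q => rfl

include hwf in
/-- The slot field as a matrix. [folklore] -/
theorem ξOfT_eq (i : ℕ) :
    ξOfT t i = matT fun s tt : Fin (I).Δ => i.testBit ((I).Lj + ((I).dNW + (tt.val + (I).Δ * s.val))) := by
  unfold ξOfT matT; rw [dNWT_toTuple I₀ hwf, LjT_toTuple, ΔT_toTuple I₀ hwf]
  exact map_range_eq_ofFn _ _ fun s =>
    (map_range_eq_ofFn (fun tt : Fin (I).Δ => i.testBit ((I).Lj + ((I).dNW + (tt.val + (I).Δ * s.val))))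
      (fun tt => i.testBit ((I).Lj + ((I).dNW + (tt + (I).Δ * s.val)))) fun tt => rfl).symm

omit hwf in
/-- The formula field. [folklore] -/
theorem jOfT_eq (i : ℕ) : jOfT t i = i % 2 ^ (I).Lj := by unfold jOfT; rw [LjT_toTuple]

include hwf in
/-- **Decoding a table index**: the bit vector of `i` is the bit vector of the point `x = (j, z, ξ)`
iff the three fields of `i` are `j`, `z`, `ξ`. [cite: Hirahara2022PartialMCSP, proof of Lemma 8.3 (x = (j, z, ξ))] -/
theorem symm_eq_xvec_iff (i : Fin (2 ^ LxOf I₀)) (x : HiraharaRed.X (I).ν (I).dNW (I).Δ (I).Δ) :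
    (boolFunEquivFin _).symm i = HiraharaRed.xvec (Lj := (I).Lj) x ↔
      x.1.val = i.val % 2 ^ (I).Lj ∧ List.ofFn x.2.1 = zOfT t i ∧ matT x.2.2 = ξOfT t i := by
  rw [zOfT_eq I₀ hwf, ξOfT_eq I₀ hwf]
  constructor
  · intro h
    have hw : ∀ w, (boolFunEquivFin _).symm i (HiraharaRed.eX (I).Lj (I).dNW (I).Δ (I).Δ w) =
        HiraharaRed.xbits (Lj := (I).Lj) x w := fun w => by rw [h, HiraharaRed.xvec_eX]
    refine ⟨?_, ?_, ?_⟩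
    · symm
      rw [← testBit_low_iff (lt_of_lt_of_le x.1.isLt (I).ν_le)]
      intro p hp
      have := hw (Sum.inl ⟨p, hp⟩)
      rw [boolFunEquivFin_symm_testBit, eX_inl_val] at this
      exact this
    · refine congrArg _ (funext fun q => ?_)
      have := hw (Sum.inr (Sum.inl q))
      rw [boolFunEquivFin_symm_testBit, eX_inr_inl_val] at this
      exact this.symm
    · refine congrArg _ (funext fun s => funext fun tt => ?_)
      have := hw (Sum.inr (Sum.inr (s, tt)))
      rw [boolFunEquivFin_symm_testBit, eX_inr_inr_val] at this
      exact this.symm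
  · rintro ⟨h1, h2, h3⟩
    funext p
    obtain ⟨w, rfl⟩ := (HiraharaRed.eX (I).Lj (I).dNW (I).Δ (I).Δ).surjective p
    rw [HiraharaRed.xvec_eX, boolFunEquivFin_symm_testBit]
    rcases w with p | q | ⟨s, tt⟩
    · rw [eX_inl_val]
      change _ = x.1.val.testBit p
      have := (testBit_low_iff (lt_of_lt_of_le x.1.isLt (I).ν_le)).2 h1.symm p p.isLt
      exact this
    · rw [eX_inr_inl_val]
      exact (congrFun (List.ofFn_injective h2) q).symm
    · rw [eX_inr_inr_val]
      exact (congrFun (congrFun (matT_injective h3) s) tt).symm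

/-- XOR cancellation on slot families. [folklore] -/
private theorem xorV_eq_iff {mm Δ : ℕ} (ξ Y S : Fin mm → Fin Δ → Bool) : S = HiraharaRed.xorV ξ Y ↔ HiraharaRed.xorV Y S = ξ := by
  constructor
  · rintro rfl; funext s tt; unfold HiraharaRed.xorV
    generalize Y s tt = a; generalize ξ s tt = c; cases a <;> cases c <;> rfl
  · rintro rfl; funext s tt; unfold HiraharaRed.xorV
    generalize Y s tt = a; generalize S s tt = c; cases a <;> cases c <;> rfl

include hwf in
/-- **The table values agree with `PT`** (under `Big`). [cite: Hirahara2022PartialMCSP, proof of Thm. 8.5 (MCSP* case)] -/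
theorem PTvalT_toTuple (hB : (I).Big) (i : Fin (2 ^ LxOf I₀)) :
    PTvalT t r i = HiraharaRed.PT (I).Lj (I).E (HiraharaRed.Fhat (I).A ((I).coinsOf r)) (I).φ (I).slot
      ((boolFunEquivFin _).symm i) := by
  classical
  have hG := hB.good
  set v := (boolFunEquivFin (LxOf I₀)).symm i with hv
  set Fh := HiraharaRed.Fhat (I).A ((I).coinsOf r) with hFh
  -- the three fields of `i`
  set zf : Fin (I).dNW → Bool := fun q => i.val.testBit ((I).Lj + q.val) with hzf
  set ξf : Fin (I).Δ → Fin (I).Δ → Bool := fun s tt => i.val.testBit ((I).Lj + ((I).dNW + (tt.val + (I).Δ * s.val))) with hξf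
  have hz : zOfT t i = List.ofFn zf := zOfT_eq I₀ hwf i
  have hξ : ξOfT t i = matT ξf := ξOfT_eq I₀ hwf i
  unfold PTvalT
  rw [jOfT_eq I₀, show νT t = (I).ν from rfl]
  by_cases hj : i.val % 2 ^ (I).Lj < (I).ν
  · rw [if_pos hj]
    set j : Fin (I).ν := ⟨_, hj⟩ with hjdef
    have hmask : maskT t r (i.val % 2 ^ (I).Lj) (zOfT t i) = matT (HiraharaRed.readY (I).slot j (HiraharaRed.realY (I).E Fh zf)) := by
      rw [hz]; exact maskT_toTuple I₀ hwf r hB j zf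
    have htarget : xorRowsT (ξOfT t i) (maskT t r (i.val % 2 ^ (I).Lj) (zOfT t i)) =
        matT (HiraharaRed.xorV ξf (HiraharaRed.readY (I).slot j (HiraharaRed.realY (I).E Fh zf))) := by
      rw [hmask, hξ, xorRowsT_matT]
    -- `hasShareT` decides being a point of secret `b`
    have hiff : ∀ b : Bool, hasShareT t (i.val % 2 ^ (I).Lj) b
        (xorRowsT (ξOfT t i) (maskT t r (i.val % 2 ^ (I).Lj) (zOfT t i))) = true ↔
        ∃ rr : MonotoneDNF.BenalohLeichter.Rand ((I).φ j), v = HiraharaRed.xvec (Lj := (I).Lj)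
          (HiraharaRed.point (I).E Fh (I).φ (I).slot j zf b rr) := by
      intro b
      rw [htarget, show (i.val % 2 ^ (I).Lj) = j.val from rfl, hasShareT_iff I₀ hwf hB j b]
      refine exists_congr fun rr => ?_
      rw [hv, symm_eq_xvec_iff I₀ hwf i, xorV_eq_iff]
      unfold HiraharaRed.point
      simp only [hz, hξ, true_and]
      constructor
      · intro h; exact ⟨rfl, congrArg matT h⟩
      · rintro ⟨-, h⟩; exact matT_injective h
    by_cases ht : hasShareT t (i.val % 2 ^ (I).Lj) true (xorRowsT (ξOfT t i) (maskT t r (i.val % 2 ^ (I).Lj) (zOfT t i))) = true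
    · rw [if_pos ht]
      obtain ⟨rr, hrr⟩ := (hiff true).1 ht
      rw [hrr, HiraharaRed.PT_xvec_point (I).ν_le hG.nil_notMem hG.ne_nil hG.numLiterals_le ((I).slot_cover hG)]
    rw [if_neg ht]
    by_cases hf : hasShareT t (i.val % 2 ^ (I).Lj) false (xorRowsT (ξOfT t i) (maskT t r (i.val % 2 ^ (I).Lj) (zOfT t i))) = true
    · rw [if_pos hf]
      obtain ⟨rr, hrr⟩ := (hiff false).1 hf
      rw [hrr, HiraharaRed.PT_xvec_point (I).ν_le hG.nil_notMem hG.ne_nil hG.numLiterals_le ((I).slot_cover hG)]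
    rw [if_neg hf]
    -- no point has these bits
    unfold HiraharaRed.PT
    rw [dif_neg]
    rintro ⟨b, j', z', rr, hx⟩
    have hdec := (symm_eq_xvec_iff I₀ hwf i _).1 hx
    unfold HiraharaRed.point at hdec
    simp only at hdec
    obtain ⟨h1, h2, -⟩ := hdec
    have hjj : j' = j := Fin.ext h1
    subst hjj
    have hzz : z' = zf := List.ofFn_injective (h2.trans hz)
    subst hzz
    cases b
    · exact hf ((hiff false).2 ⟨rr, hx⟩)
    · exact ht ((hiff true).2 ⟨rr, hx⟩)
  · rw [if_neg hj]
    unfold HiraharaRed.PT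
    rw [dif_neg]
    rintro ⟨b, j', z', rr, hx⟩
    have hdec := (symm_eq_xvec_iff I₀ hwf i _).1 hx
    unfold HiraharaRed.point at hdec
    exact hj (hdec.1 ▸ j'.isLt)

/-! ### The output -/

include hwf in
/-- **The table agrees.** [cite: Hirahara2022PartialMCSP, proof of Thm. 8.5] -/
theorem tableT_toTuple (hB : (I).Big) :
    tableT t r = List.ofFn fun i : Fin (2 ^ LxOf I₀) =>
      HiraharaRed.PT (I).Lj (I).E (HiraharaRed.Fhat (I).A ((I).coinsOf r)) (I).φ (I).slot ((boolFunEquivFin _).symm i) := by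
  unfold tableT
  rw [min_eq_left (two_pow_Lx_le_budgetT I₀ hwf hB), LxT_toTuple I₀ hwf]
  exact map_range_eq_ofFn _ _ fun i => (PTvalT_toTuple I₀ hwf r hB i).symm

include hwf in
/-- **The main output on lists is the specified output.** [cite: Hirahara2022PartialMCSP, proof of Thm. 8.5 (output (f, s_P))] -/
theorem mainOutT_toTuple (hB : (I).Big) : mainOutT t r = (I).output ((I).coinsOf r) := by
  unfold mainOutT HiraharaRed.PInst.output HiraharaRed.tableCode
  rw [tableT_toTuple I₀ hwf r hB, sPT_toTuple I₀ hwf, CodeFP.listE_eq]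
  rfl

end Agree

end HiraharaMachine

end Literature.Computability.Complexity
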